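import Summits.AtomisticToContinuum.Crystallization.Theorems.FrustratedLawDichotomyStrainedPatchHomCurvRegime3
import Summits.AtomisticToContinuum.Crystallization.Theorems.FrustratedLawDichotomyStrainedPatchHomCurvCoeff

/-!
# Kernel enclosures of the EVEN coefficient combinations `α, α′ρ, α″ρ²` on the bump and LJ regimes, and the one-sided remainder constant (centred leaf)

decomp-a2c hand-1 g27 (crux `AperiodicFrustratedLawGap`, stmt-AtomisticToContinuum-27623; `(H) HomFloor (1/625)`, hcp half; lever (C)).  The `hK`
input of `…HomHessPath.pathForm_secondOrder` — `[A₂]₋r² + [A₁]₋r + 4|A₁|r + 2[A]₋ + [B₂]₋ + [B₁]₋/r ≤ K` with `B₁ = αρ`, `B₂ = α′ρ + α` — only involves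
the three EVEN combinations `α`, `α′ρ`, `α″ρ²`, which on the LJ regime are polynomials in `u = ρ⁻²` (`14u⁸ − 8u⁵`, `−224u⁸ + 80u⁵`, `3808u⁸ − 880u⁵`)
and on the bump regime differ from these by polynomials in `w = 5ρ/4` (`(75/2048)·{T(w), wT′(w), w²T″(w)}`, `…HomCurvRegime3.bumpT/T1/T2`):

* §1 `ljTripleFI Q`, `bumpTripleFI Q W` (fixed-point enclosures, `Q ∋ ρ²`, `W ∋ 5ρ/4`) + ★ `mem_ljTripleFI`, ★ `mem_bumpTripleFI`;
* §2 `kTermS I0 I1 I2 : ℤ` and ★★ `kBound_of_mem`: memberships `α(r) ∈ I0`, `α′(r)r ∈ I1`, `α″(r)r² ∈ I2` ⟹ the `hK` bracket is `≤ kTermS/SC`.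

Kernel definitions (FI/ℤ-valued, docstring'd) + soundness; 0 sorry; standard axioms; no instances / notation / `#eval`.  `--supports stmt-AtomisticToContinuum-27623`.
-/

noncomputable section

namespace Summit.AtomisticToContinuum.Crystallization.Theorems.FrustratedLawDichotomyStrainedPatchHomCurvCoeff3

open Literature.Analysis.ValidatedNumerics.Numerics
open Summit.AtomisticToContinuum.Crystallization.Theorems.FrustratedLawDichotomyStrainedPatchHomCurvRegime3
open Summit.AtomisticToContinuum.Crystallization.Theorems.FrustratedLawDichotomyStrainedPatchHomCurvCoeff (wFI mem_wFI)

/-! ## §1. The three even combinations, LJ and bump -/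

/-- `(14u⁸ − 8u⁵, −224u⁸ + 80u⁵, 3808u⁸ − 880u⁵)` with `u ∋ q⁻¹` (`none` iff `Q` reaches `0`): encloses `(α, α′ρ, α″ρ²)` on the LJ regime. -/
def ljTripleFI (Q : FI) : Option (FI × FI × FI) :=
  match FI.divPos (FI.ofInt 1) Q with
  | none => none
  | some u =>
    let u2 := u.mul u
    let u4 := u2.mul u2
    let u5 := u4.mul u
    let u8 := u4.mul u4
    some ((u8.mulInt 14).sub (u5.mulInt 8), (u5.mulInt 80).sub (u8.mulInt 224), (u8.mulInt 3808).sub (u5.mulInt 880))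

/-- `(ρ²)⁻¹ ^ k = (ρ⁻¹) ^ (2k)`. [arithmetic] -/
theorem inv_sq_pow (ρ : ℝ) (k : ℕ) : ((ρ ^ 2)⁻¹) ^ k = (ρ⁻¹) ^ (2 * k) := by
  rw [← inv_pow, ← pow_mul]

/-- ★ Soundness of `ljTripleFI` against `…HomCurvRegime3.alphaLJ / alpha1LJ / alpha2LJ`. [folklore] -/
theorem mem_ljTripleFI {ρ : ℝ} {Q : FI} {T : FI × FI × FI} (hq : FI.mem (ρ ^ 2) Q) (h : ljTripleFI Q = some T) :
    FI.mem (alphaLJ ρ) T.1 ∧ FI.mem (alpha1LJ ρ * ρ) T.2.1 ∧ FI.mem (alpha2LJ ρ * ρ ^ 2) T.2.2 := by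
  unfold ljTripleFI at h
  cases hdiv : FI.divPos (FI.ofInt 1) Q with
  | none => rw [hdiv] at h; exact absurd h (by simp)
  | some u =>
    rw [hdiv] at h
    simp only [Option.some.injEq] at h
    subst h
    have hu : FI.mem ((ρ ^ 2)⁻¹) u := by
      have := FI.mem_divPos hdiv (by simpa using FI.mem_ofInt 1) hq
      simpa [one_div] using this
    have hu2 : FI.mem ((ρ ^ 2)⁻¹ ^ 2) (u.mul u) := by rw [pow_two]; exact FI.mem_mul hu hu
    have hu4 : FI.mem ((ρ ^ 2)⁻¹ ^ 4) ((u.mul u).mul (u.mul u)) := by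
      rw [show (ρ ^ 2)⁻¹ ^ 4 = (ρ ^ 2)⁻¹ ^ 2 * (ρ ^ 2)⁻¹ ^ 2 by ring]; exact FI.mem_mul hu2 hu2
    have hu5 : FI.mem ((ρ ^ 2)⁻¹ ^ 5) (((u.mul u).mul (u.mul u)).mul u) := by
      rw [show (ρ ^ 2)⁻¹ ^ 5 = (ρ ^ 2)⁻¹ ^ 4 * (ρ ^ 2)⁻¹ by ring]; exact FI.mem_mul hu4 hu
    have hu8 : FI.mem ((ρ ^ 2)⁻¹ ^ 8) (((u.mul u).mul (u.mul u)).mul ((u.mul u).mul (u.mul u))) := by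
      rw [show (ρ ^ 2)⁻¹ ^ 8 = (ρ ^ 2)⁻¹ ^ 4 * (ρ ^ 2)⁻¹ ^ 4 by ring]; exact FI.mem_mul hu4 hu4
    have e8 : (ρ ^ 2)⁻¹ ^ 8 = (ρ⁻¹) ^ 16 := by rw [inv_sq_pow]
    have e5 : (ρ ^ 2)⁻¹ ^ 5 = (ρ⁻¹) ^ 10 := by rw [inv_sq_pow]
    rw [e8] at hu8
    rw [e5] at hu5
    refine ⟨?_, ?_, ?_⟩
    · have := FI.mem_sub (FI.mem_mulInt hu8 14) (FI.mem_mulInt hu5 8)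
      simp only [alphaLJ]
      push_cast at this
      convert this using 1; ring
    · have := FI.mem_sub (FI.mem_mulInt hu5 80) (FI.mem_mulInt hu8 224)
      have e : alpha1LJ ρ * ρ = (ρ⁻¹) ^ 10 * (80 : ℤ) - (ρ⁻¹) ^ 16 * (224 : ℤ) := by
        by_cases hρ : ρ = 0
        · subst hρ; simp [alpha1LJ]
        · have p17 : (ρ⁻¹) ^ 17 * ρ = (ρ⁻¹) ^ 16 := by rw [pow_succ, mul_assoc, inv_mul_cancel₀ hρ, mul_one]
          have p11 : (ρ⁻¹) ^ 11 * ρ = (ρ⁻¹) ^ 10 := by rw [pow_succ, mul_assoc, inv_mul_cancel₀ hρ, mul_one]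
          calc alpha1LJ ρ * ρ = -224 * ((ρ⁻¹) ^ 17 * ρ) + 80 * ((ρ⁻¹) ^ 11 * ρ) := by rw [alpha1LJ]; ring
            _ = (ρ⁻¹) ^ 10 * (80 : ℤ) - (ρ⁻¹) ^ 16 * (224 : ℤ) := by rw [p17, p11]; push_cast; ring
      rw [e]; exact this
    · have := FI.mem_sub (FI.mem_mulInt hu8 3808) (FI.mem_mulInt hu5 880)
      have e : alpha2LJ ρ * ρ ^ 2 = (ρ⁻¹) ^ 16 * (3808 : ℤ) - (ρ⁻¹) ^ 10 * (880 : ℤ) := by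
        by_cases hρ : ρ = 0
        · subst hρ; simp [alpha2LJ]
        · have p18 : (ρ⁻¹) ^ 18 * ρ ^ 2 = (ρ⁻¹) ^ 16 := by
            rw [show (18 : ℕ) = 16 + 2 by norm_num, pow_add, mul_assoc, ← mul_pow, inv_mul_cancel₀ hρ, one_pow, mul_one]
          have p12 : (ρ⁻¹) ^ 12 * ρ ^ 2 = (ρ⁻¹) ^ 10 := by
            rw [show (12 : ℕ) = 10 + 2 by norm_num, pow_add, mul_assoc, ← mul_pow, inv_mul_cancel₀ hρ, one_pow, mul_one]
          calc alpha2LJ ρ * ρ ^ 2 = 3808 * ((ρ⁻¹) ^ 18 * ρ ^ 2) - 880 * ((ρ⁻¹) ^ 12 * ρ ^ 2) := by rw [alpha2LJ]; ring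
            _ = (ρ⁻¹) ^ 16 * (3808 : ℤ) - (ρ⁻¹) ^ 10 * (880 : ℤ) := by rw [p18, p12]; push_cast; ring
      rw [e]; exact this

/-- `T(w)` by Horner in `w, w²`. -/
def bumpTFI (W : FI) : FI :=
  let w2 := W.mul W
  let t6 := (FI.ofFrac (-693) 1024).add (w2.mul (FI.ofFrac 495 12288))
  let t4 := (FI.ofFrac 1155 256).add (w2.mul t6)
  let t2 := (FI.ofFrac (-1155) 64).add (w2.mul t4)
  (FI.ofFrac 33 2).add (W.mul t2)

/-- [folklore] -/
theorem mem_bumpTFI {w : ℝ} {W : FI} (h : FI.mem w W) : FI.mem (bumpT w) (bumpTFI W) := by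
  have hw2 : FI.mem (w * w) (W.mul W) := FI.mem_mul h h
  have h6 := FI.mem_add (FI.mem_ofFrac (-693) (q := 1024) (by norm_num)) (FI.mem_mul hw2 (FI.mem_ofFrac 495 (q := 12288) (by norm_num)))
  have h4 := FI.mem_add (FI.mem_ofFrac 1155 (q := 256) (by norm_num)) (FI.mem_mul hw2 h6)
  have h2 := FI.mem_add (FI.mem_ofFrac (-1155) (q := 64) (by norm_num)) (FI.mem_mul hw2 h4)
  have h0 := FI.mem_add (FI.mem_ofFrac 33 (q := 2) (by norm_num)) (FI.mem_mul h h2)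
  have e : ((33 : ℤ) : ℝ) / (2 : ℕ) + w * (((-1155 : ℤ) : ℝ) / (64 : ℕ) + w * w * (((1155 : ℤ) : ℝ) / (256 : ℕ) +
      w * w * (((-693 : ℤ) : ℝ) / (1024 : ℕ) + w * w * (((495 : ℤ) : ℝ) / (12288 : ℕ))))) = bumpT w := by
    rw [bumpT]; push_cast; ring
  rw [← e]
  simpa [bumpTFI] using h0

/-- `w·T′(w)` by Horner. -/
def bumpWT1FI (W : FI) : FI :=
  let w2 := W.mul W
  let t4 := (FI.ofFrac (-3465) 1024).add (w2.mul (FI.ofFrac 3465 12288))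
  let t2 := (FI.ofFrac 3465 256).add (w2.mul t4)
  W.mul ((FI.ofFrac (-1155) 64).add (w2.mul t2))

/-- [folklore] -/
theorem mem_bumpWT1FI {w : ℝ} {W : FI} (h : FI.mem w W) : FI.mem (w * bumpT1 w) (bumpWT1FI W) := by
  have hw2 : FI.mem (w * w) (W.mul W) := FI.mem_mul h h
  have h4 := FI.mem_add (FI.mem_ofFrac (-3465) (q := 1024) (by norm_num)) (FI.mem_mul hw2 (FI.mem_ofFrac 3465 (q := 12288) (by norm_num)))
  have h2 := FI.mem_add (FI.mem_ofFrac 3465 (q := 256) (by norm_num)) (FI.mem_mul hw2 h4)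
  have h0 := FI.mem_mul h (FI.mem_add (FI.mem_ofFrac (-1155) (q := 64) (by norm_num)) (FI.mem_mul hw2 h2))
  have e : w * (((-1155 : ℤ) : ℝ) / (64 : ℕ) + w * w * (((3465 : ℤ) : ℝ) / (256 : ℕ) + w * w * (((-3465 : ℤ) : ℝ) / (1024 : ℕ) +
      w * w * (((3465 : ℤ) : ℝ) / (12288 : ℕ))))) = w * bumpT1 w := by
    rw [bumpT1]; push_cast; ring
  rw [← e]
  simpa [bumpWT1FI] using h0

/-- `w²·T″(w)` by Horner. -/
def bumpW2T2FI (W : FI) : FI :=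
  let w2 := W.mul W
  let t2 := (FI.ofFrac (-3465) 256).add (w2.mul (FI.ofFrac 3465 2048))
  (w2.mul W).mul ((FI.ofFrac 3465 128).add (w2.mul t2))

/-- [folklore] -/
theorem mem_bumpW2T2FI {w : ℝ} {W : FI} (h : FI.mem w W) : FI.mem (w ^ 2 * bumpT2 w) (bumpW2T2FI W) := by
  have hw2 : FI.mem (w * w) (W.mul W) := FI.mem_mul h h
  have h2 := FI.mem_add (FI.mem_ofFrac (-3465) (q := 256) (by norm_num)) (FI.mem_mul hw2 (FI.mem_ofFrac 3465 (q := 2048) (by norm_num)))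
  have h0 := FI.mem_mul (FI.mem_mul hw2 h) (FI.mem_add (FI.mem_ofFrac 3465 (q := 128) (by norm_num)) (FI.mem_mul hw2 h2))
  have e : w * w * w * (((3465 : ℤ) : ℝ) / (128 : ℕ) + w * w * (((-3465 : ℤ) : ℝ) / (256 : ℕ) + w * w * (((3465 : ℤ) : ℝ) / (2048 : ℕ)))) =
      w ^ 2 * bumpT2 w := by
    rw [bumpT2]; push_cast; ring
  rw [← e]
  simpa [bumpW2T2FI] using h0

/-- Scaling by `75/2048`. -/
def k75 (I : FI) : FI := (I.mulInt 75).divNat 2048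

/-- [folklore] -/
theorem mem_k75 {x : ℝ} {I : FI} (h : FI.mem x I) : FI.mem (75 / 2048 * x) (k75 I) := by
  have := FI.mem_divNat (FI.mem_mulInt h 75) (n := 2048) (by norm_num)
  push_cast at this
  unfold k75
  convert this using 1; ring

/-- ★ `(α_B, α_B′ρ, α_B″ρ²)` enclosure on the bump regime: LJ triple minus `(75/2048)·(T, wT′, w²T″)(w)`, `W ∋ w = 5ρ/4`. -/
def bumpTripleFI (Q W : FI) : Option (FI × FI × FI) :=
  match ljTripleFI Q with
  | none => none
  | some T => some (T.1.sub (k75 (bumpTFI W)), T.2.1.sub (k75 (bumpWT1FI W)), T.2.2.sub (k75 (bumpW2T2FI W)))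

/-- ★ Soundness of `bumpTripleFI` against `…HomCurvRegime3.alphaB / alpha1B / alpha2B`. [folklore] -/
theorem mem_bumpTripleFI {ρ : ℝ} {Q W : FI} {T : FI × FI × FI} (hq : FI.mem (ρ ^ 2) Q) (hw : FI.mem (5 * ρ / 4) W)
    (h : bumpTripleFI Q W = some T) :
    FI.mem (alphaB ρ) T.1 ∧ FI.mem (alpha1B ρ * ρ) T.2.1 ∧ FI.mem (alpha2B ρ * ρ ^ 2) T.2.2 := by
  unfold bumpTripleFI at h
  cases hl : ljTripleFI Q with
  | none => rw [hl] at h; exact absurd h (by simp)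
  | some T0 =>
    rw [hl] at h
    simp only [Option.some.injEq] at h
    subst h
    obtain ⟨m0, m1, m2⟩ := mem_ljTripleFI hq hl
    refine ⟨?_, ?_, ?_⟩
    · have := FI.mem_sub m0 (mem_k75 (mem_bumpTFI hw))
      have e : alphaB ρ = alphaLJ ρ - 75 / 2048 * bumpT (5 * ρ / 4) := rfl
      rw [e]; exact this
    · have := FI.mem_sub m1 (mem_k75 (mem_bumpWT1FI hw))
      have e : alpha1B ρ * ρ = alpha1LJ ρ * ρ - 75 / 2048 * (5 * ρ / 4 * bumpT1 (5 * ρ / 4)) := by rw [alpha1B]; ring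
      rw [e]; exact this
    · have := FI.mem_sub m2 (mem_k75 (mem_bumpW2T2FI hw))
      have e : alpha2B ρ * ρ ^ 2 = alpha2LJ ρ * ρ ^ 2 - 75 / 2048 * ((5 * ρ / 4) ^ 2 * bumpT2 (5 * ρ / 4)) := by rw [alpha2B]; ring
      rw [e]; exact this

/-! ## §2. The one-sided remainder constant from the three memberships -/

/-- ★ The scaled `hK` bracket from enclosures `I0 ∋ α`, `I1 ∋ α′ρ`, `I2 ∋ α″ρ²`:
`[I2]₋ + [I1]₋ + 4|I1| + 2[I0]₋ + [I1 + I0]₋ + [I0]₋` (`[I]₋ = max 0 (−lo)`, `|I| = absHi`). -/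
def kTermS (I0 I1 I2 : FI) : ℤ :=
  max 0 (-I2.lo) + max 0 (-I1.lo) + 4 * I1.absHi + 2 * max 0 (-I0.lo) + max 0 (-(I1.add I0).lo) + max 0 (-I0.lo)

/-- `[x]₋ ≤ [I]₋/SC` for `x ∈ I`. [folklore] -/
theorem negPart_le_of_mem {x : ℝ} {I : FI} (h : FI.mem x I) : max 0 (-x) ≤ ((max 0 (-I.lo) : ℤ) : ℝ) / SC := by
  have hS : (0 : ℝ) < SC := by norm_num [SC]
  have hlo : (I.lo : ℝ) ≤ x * SC := h.1
  rw [le_div_iff₀ hS]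
  push_cast
  rcases le_or_gt 0 x with hx | hx
  · rw [max_eq_left (by linarith)]; simp only [zero_mul]; exact le_max_left _ _
  · rw [max_eq_right (by linarith)]
    exact le_trans (by linarith) (le_max_right _ _)

/-- `|x| ≤ absHi I / SC` for `x ∈ I`. [folklore] -/
theorem abs_le_of_mem {x : ℝ} {I : FI} (h : FI.mem x I) : |x| ≤ ((I.absHi : ℤ) : ℝ) / SC := by
  have hS : (0 : ℝ) < SC := by norm_num [SC]
  rw [le_div_iff₀ hS]
  exact FI.abs_le_absHi h

/-- `[a]₋·c = [a·c]₋` for `c ≥ 0`. [arithmetic] -/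
theorem negPart_mul_nonneg (a : ℝ) {c : ℝ} (hc : 0 ≤ c) : max 0 (-a) * c = max 0 (-(a * c)) := by
  rw [max_mul_of_nonneg _ _ hc, zero_mul, neg_mul]

/-- ★★ **THE `hK` BRACKET FROM THREE MEMBERSHIPS.**  For `r > 0` and `α(r) ∈ I0`, `α′(r)·r ∈ I1`, `α″(r)·r² ∈ I2`:
`[α″]₋r² + [α′]₋r + 4|α′|r + 2[α]₋ + [α′r + α]₋ + [αr]₋/r ≤ kTermS I0 I1 I2 / SC` — the `hK` hypothesis of `…HomHessPath.pathForm_secondOrder` with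
`A₂ = α″`, `A₁ = α′`, `A = α`, `B₂ = α′ρ + α`, `B₁ = αρ`. [folklore chaining] -/
theorem kBound_of_mem {A A1 A2 r : ℝ} (hr : 0 < r) {I0 I1 I2 : FI} (h0 : FI.mem A I0) (h1 : FI.mem (A1 * r) I1) (h2 : FI.mem (A2 * r ^ 2) I2) :
    max 0 (-A2) * r ^ 2 + max 0 (-A1) * r + 4 * |A1| * r + 2 * max 0 (-A) + max 0 (-(A1 * r + A)) + max 0 (-(A * r)) / r ≤
      ((kTermS I0 I1 I2 : ℤ) : ℝ) / SC := by
  have hS : (0 : ℝ) < SC := by norm_num [SC]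
  have e2 : max 0 (-A2) * r ^ 2 = max 0 (-(A2 * r ^ 2)) := negPart_mul_nonneg A2 (by positivity)
  have e1 : max 0 (-A1) * r = max 0 (-(A1 * r)) := negPart_mul_nonneg A1 hr.le
  have e3 : 4 * |A1| * r = 4 * |A1 * r| := by rw [abs_mul, abs_of_pos hr]; ring
  have e6 : max 0 (-(A * r)) / r = max 0 (-A) := by
    rw [← negPart_mul_nonneg A hr.le, mul_div_assoc, div_self hr.ne', mul_one]
  rw [e2, e1, e3, e6]
  have t2 := negPart_le_of_mem h2
  have t1 := negPart_le_of_mem h1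
  have t3 := abs_le_of_mem h1
  have t0 := negPart_le_of_mem h0
  have t5 := negPart_le_of_mem (FI.mem_add h1 h0)
  unfold kTermS
  push_cast at t2 t1 t3 t0 t5 ⊢
  have hsum : max 0 (-(A2 * r ^ 2)) + max 0 (-(A1 * r)) + 4 * |A1 * r| + 2 * max 0 (-A) + max 0 (-(A1 * r + A)) + max 0 (-A) ≤
      (max 0 (-(I2.lo : ℝ))) / SC + (max 0 (-(I1.lo : ℝ))) / SC + 4 * ((I1.absHi : ℝ) / SC) + 2 * ((max 0 (-(I0.lo : ℝ))) / SC) +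
        (max 0 (-((I1.add I0).lo : ℝ))) / SC + (max 0 (-(I0.lo : ℝ))) / SC := by
    linarith
  refine hsum.trans (le_of_eq ?_)
  field_simp

end Summit.AtomisticToContinuum.Crystallization.Theorems.FrustratedLawDichotomyStrainedPatchHomCurvCoeff3

end
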